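import Summits.BirchSwinnertonDyer.BirchSwinnertonDyer.Theorems.KolyvaginDepthDoorDepthTableRankTwo389a1TwistBSDQuotient
import Summits.BirchSwinnertonDyer.BirchSwinnertonDyer.Theorems.KolyvaginDepthDoorDepthTableSteinWuthrichUniform389a1
import Summits.BirchSwinnertonDyer.BirchSwinnertonDyer.Theorems.KolyvaginDepthDoorDepthTableSteinWuthrichTwistTolerance
import Summits.BirchSwinnertonDyer.BirchSwinnertonDyer.Theorems.KolyvaginDepthDoorSurjectiveModPQuadraticTwist
import Summits.BirchSwinnertonDyer.BirchSwinnertonDyer.Theorems.KolyvaginDepthDoorDepthTableRowsExactReading944e1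
import Literature.NumberTheory.EllipticCurves.QuadraticTwistProofs
import Summits.BirchSwinnertonDyer.BirchSwinnertonDyer.Theorems.KolyvaginDepthDoorDepthTableSteinWuthrichEvenRankBSDQuotientExact
import HarnessLib

/-!
# Route `KolyvaginDepthDoor`, crux `KolyvaginDepthSupplyKN` (stmt-BirchSwinnertonDyer-22820) —
# DEPTH TABLE v15, the even-rank row `389a1` UNIFORM IN THE PRIME: the crux at `389a1` from ONE BSD-quotient valuation of the
# Heegner twist `E^{(−7)}` AT ANY admissible `p < 1000`, with tolerance `ord_p ≤ 1`

Helper file of the lead prover of line `levelone` (kdd-p1 g19; `--supports stmt-BirchSwinnertonDyer-22820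
--as helper`); it closes nothing and BSD is NOT proved by it.

g17's `C389a1.cruxBody_of_twistSelmer_at` gives the clause of the crux at `389a1` from `#Sel_p(E^{(−7)}) ≤ p²` at ANY admissible
`5 ≤ p < 1000`, `p ≠ 7` (`p` good ordinary with `ρ_{E,p^n}` onto, as hypotheses). With the g19 minimal model
`T₀ = [0, −1, 1, −114, −302]` of `E^{(−7)}` (`…RankTwo389a1TwistBSDQuotient`) every `T`-side condition is now UNIFORM in `p`:
`ρ̄_{T,p}` onto follows from `ρ̄_{E,p}` onto by the new generic `hasSurjectiveModNGaloisRep_of_smul_eq_quadraticTwist`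
(`…SurjectiveModPQuadraticTwist`; no Serre witnesses needed); good reduction of `T₀` at `p` from `p ∤ Δ(T₀) = 7⁶·389` (`p ≠ 7`,
and `p = 389` is excluded by `E` being good at `p`); Kodaira–Néron for `T₀` at every `p ≥ 5` (exponents `6, 1`). Only the
ORDINARITY of `T₀` at `p` stays a hypothesis (`a_p(E^{(−7)}) = (−7/p)·a_p(E)`, not in the tree). With the tolerance lemma
(`natCard_selmerGroup_le_pow_succ_of_rankOne_bsdQuotient_bcs`, `k = 1`):

* `cruxBody_of_twistBSDQuotient_at` — for every admissible `p` as above and ONE `K` with `d_K = −7`: IF `ord_{s=1} L(T₀,s) = 1` and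
  `ord_p(L'(T₀,1)/(Ω·Reg)) ≤ 1` (and `p ∤ a_p(T₀)`), THEN the clause of `KolyvaginDepthSupplyKN` holds at `389a1` VERBATIM with
  witness prime `p`. The even-rank twin of g18's `…5077a1LValueUniform`.

CONDITIONAL on Stein–Wuthrich 2013 Thm. 1.1, W. Zhang 2014 L8.4 (1) / 9.1, Burungale–Castella–Skinner 2025 Cor. 1.3.1 and GZK by name;
per curve; nothing class-wide (the open stub (S♭) is untouched); BSD is NOT proved by it.

References: [BurungaleCastellaSkinner2025] Cor. 1.3.1; [Darmon2004] Thm. 3.22; [SteinWuthrich2013] Thm. 1.1; [WZhang2014] L8.4 (1),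
Thm. 9.1; [SilvermanAEC2009] VII.5.1, VIII.8, X.4.2, X.5 Cor. 5.4.
-/

set_option linter.dupNamespace false

noncomputable section

open scoped Classical NumberField

namespace Summit.BirchSwinnertonDyer.BirchSwinnertonDyer.Theorems.KolyvaginDepthDoor

open Literature.NumberTheory.EllipticCurves Literature.NumberTheory.EllipticCurves.ModularForms
  WeierstrassCurve NumberField IsDedekindDomain
open Summit.BirchSwinnertonDyer.BirchSwinnertonDyer.Theorems
open Summit.BirchSwinnertonDyer.BirchSwinnertonDyer.Rank2Observatory
open Summit.BirchSwinnertonDyer.BirchSwinnertonDyer.Rank1Residual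
open Summit.BirchSwinnertonDyer.Rank1Residual.Additive

namespace C389a1

/-- **Kodaira–Néron for `T₀ = [0,−1,1,−114,−302]` at EVERY `p ≥ 5`**: `Δ(T₀) = 7⁶·389`; the place above `7` is ADDITIVE (`7 ∣ c₄ = 5488`),
the multiplicative place above `389` has exponent `1` (additive-aware table lemma with `B = 390`, `|Δ| < 390⁵ ≤ 390^p`).
[cite: SilvermanAEC2009, VII.5 Prop. 5.1 (c), VIII.8] -/
theorem minTwist7_kodairaNeron_of_five_le (p : ℕ) (h5 : 5 ≤ p) :
    haveI := minTwist7_isElliptic; haveI := minTwist7_isGloballyMinimal;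
    ∀ v : HeightOneSpectrum (𝓞 ℚ),
      ((⟨0, -1, 1, -114, -302⟩ : WeierstrassCurve ℤ).map (Int.castRingHom ℚ)).HasMultiplicativeReductionAt v →
      ¬ p ∣ ((⟨0, -1, 1, -114, -302⟩ : WeierstrassCurve ℤ).map (Int.castRingHom ℚ)).ordMinimalDiscriminant v := by
  haveI := minTwist7_isElliptic
  haveI := minTwist7_isGloballyMinimal
  refine not_dvd_ordMinimalDiscriminant_of_intModel_table_additive minTwist7_intModel (p := p) (Δ₀ := 45765461)
    (c₀ := 5488) (by decide +kernel) (by decide +kernel) (B := 390)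
    (lt_of_lt_of_le (by norm_num) (Nat.pow_le_pow_right (by norm_num) h5)) ?_
  intro q hq hqP hqd
  have hn : ((45765461 : ℤ).natAbs) = 7 ^ 6 * 389 ^ 1 := by norm_num
  rw [hn] at hqd ⊢
  rcases (Nat.Prime.dvd_mul hqP).mp hqd with h | h0
  · obtain rfl := (Nat.prime_dvd_prime_iff_eq hqP (by norm_num)).mp (hqP.dvd_of_dvd_pow h)
    exact Or.inl (by norm_num)
  · obtain rfl := (Nat.prime_dvd_prime_iff_eq hqP (by norm_num)).mp (hqP.dvd_of_dvd_pow h0)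
    exact Or.inr ⟨1, by simp, by decide +kernel, by decide +kernel, fun h1 ↦ by
      have : p ≤ 1 := Nat.le_of_dvd one_pos h1; omega⟩

/-- **`T₀` has good reduction at every prime `p ≠ 7` at which `E = 389a1` has good reduction** (`Δ(T₀) = 7⁶·389`; `p = 389` is
multiplicative for `E`). [cite: SilvermanAEC2009, VII.5 Prop. 5.1 (a)] -/
theorem minTwist7_hasGoodReductionAtPrime_of (p : ℕ) [hp : Fact p.Prime] (hp7 : p ≠ 7)
    (hgood : haveI := curve389a1_isGloballyMinimal; Curve389a1.E.HasGoodReductionAtPrime p) :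
    haveI := minTwist7_isGloballyMinimal;
    ((⟨0, -1, 1, -114, -302⟩ : WeierstrassCurve ℤ).map (Int.castRingHom ℚ)).HasGoodReductionAtPrime p := by
  haveI := curve389a1_isGloballyMinimal
  haveI := minTwist7_isElliptic
  haveI := minTwist7_isGloballyMinimal
  have hp389 : p ≠ 389 := by
    rintro rfl
    exact WeierstrassCurve.HasMultiplicativeReduction.not_hasGoodReduction (R := ℤ_[389])
      (IntModel.hasMultiplicativeReductionAtPrime_of_intModel intModel 389 (by decide +kernel) (by decide +kernel)) hgood
  refine hasGoodReductionAtPrime_of_not_dvd _ p ?_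
  rw [IntModel.minimalDiscriminantInt_eq minTwist7_intModel]
  have hΔ : (⟨0, -1, 1, -114, -302⟩ : WeierstrassCurve ℤ).Δ = 45765461 := by decide +kernel
  rw [hΔ]
  intro hdvd
  have hq : p ∣ 7 ^ 6 * 389 := by exact_mod_cast hdvd
  rcases (Nat.Prime.dvd_mul hp.out).mp hq with h | h
  · exact hp7 ((Nat.prime_dvd_prime_iff_eq hp.out (by norm_num)).mp (hp.out.dvd_of_dvd_pow h))
  · exact hp389 ((Nat.prime_dvd_prime_iff_eq hp.out (by norm_num)).mp h)

/-- **THE CRUX `KolyvaginDepthSupplyKN` AT `389a1` FROM ONE BSD-QUOTIENT VALUATION AT ANY ADMISSIBLE PRIME, WITH TOLERANCE.** For every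
`5 ≤ p < 1000`, `p ≠ 7`, with `E = 389a1` good ordinary at `p` and `ρ_{E,p^n}` onto (hypotheses, as in `cruxBody_of_twistSelmer_at`), ONE
imaginary quadratic `K` with `d_K = −7`, and the minimal model `T₀ = [0,−1,1,−114,−302]` of `E^{(−7)}`: IF `T₀` is ordinary at `p`
(`p ∤ a_p(T₀)`; `a_p(T₀) = (−7/p)·a_p(E)`), `ord_{s=1} L(T₀,s) = 1` and `ord_p(L'(T₀,1)/(Ω_{T₀}·Reg_{T₀})) ≤ 1`, THEN the clause of the
crux holds at `389a1` VERBATIM. `ρ̄_{T,p}` onto is DERIVED from `ρ̄_{E,p}` onto (`hasSurjectiveModNGaloisRep_of_smul_eq_quadraticTwist`),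
good reduction and Kodaira–Néron of `T₀` at `p` are uniform kernel facts, `#Sel_p(T₀) ≤ p²` by the tolerance lemma
(`natCard_selmerGroup_le_pow_succ_of_rankOne_bsdQuotient_bcs`, `k = 1`), transport along `minTwist7_smul_eq`, then g17's
`cruxBody_of_twistSelmer_at`. CONDITIONAL on SW Thm. 1.1, W. Zhang L8.4 (1) / 9.1, BCS 2025 Cor. 1.3.1, GZK by name; per curve; BSD is
not proved by it. [cite: BurungaleCastellaSkinner2025, Cor. 1.3.1 (p. 4)] [cite: Darmon2004, Thm. 3.22]
[cite: SteinWuthrich2013, Thm. 1.1 (p. 1758)] [cite: WZhang2014, Lemma 8.4 (1) (p. 236), Thm. 9.1 (p. 240)] -/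
theorem cruxBody_of_twistBSDQuotient_at
    (hSW : SteinWuthrich2013_sha_inf_torsionBy_eq_bot_of_two_le_rank)
    (h84 : Literature.NumberTheory.EllipticCurves.WZhang2014_lemma84_exists_minimal_kolyvaginClass_one_selmerCard)
    (hBCS : BurungaleCastellaSkinner2025.cor131_padicValRat_bsd_rank_le_one)
    (hGZK : rank_eq_analyticRank_of_analyticRank_le_one)
    (p : ℕ) [hp : Fact p.Prime] (h5 : 5 ≤ p) (hp1000 : p < 1000) (hp7 : p ≠ 7)
    (hgood : haveI := curve389a1_isGloballyMinimal; Curve389a1.E.HasGoodReductionAtPrime p)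
    (hord : haveI := curve389a1_isGloballyMinimal; ¬ (p : ℤ) ∣ Curve389a1.E.frobeniusTrace p)
    (htower : ∀ n : ℕ, Curve389a1.E.HasSurjectiveModNGaloisRep (p ^ n : ℕ))
    (K : Type) [Field K] [NumberField K] (hK : IsImaginaryQuadratic K) (hD : NumberField.discr K = -7)
    (hTord : haveI := minTwist7_isGloballyMinimal;
      ¬ (p : ℤ) ∣ ((⟨0, -1, 1, -114, -302⟩ : WeierstrassCurve ℤ).map (Int.castRingHom ℚ)).frobeniusTrace p)
    (hr : haveI := minTwist7_isElliptic;
      ((⟨0, -1, 1, -114, -302⟩ : WeierstrassCurve ℤ).map (Int.castRingHom ℚ)).analyticRank = 1)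
    (hval : haveI := minTwist7_isElliptic; haveI := minTwist7_isGloballyMinimal;
      ∀ q : ℚ, ((⟨0, -1, 1, -114, -302⟩ : WeierstrassCurve ℤ).map (Int.castRingHom ℚ)).leadingLCoeff /
          (((((⟨0, -1, 1, -114, -302⟩ : WeierstrassCurve ℤ).map (Int.castRingHom ℚ)).realPeriodRat *
              ((⟨0, -1, 1, -114, -302⟩ : WeierstrassCurve ℤ).map (Int.castRingHom ℚ)).regulator : ℝ)) : ℂ) = (q : ℂ) →
        padicValRat p q ≤ 1) :
    haveI := curve389a1_isGloballyMinimal;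
    ∃ (p : ℕ) (hp : Fact p.Prime), 5 ≤ p ∧ Curve389a1.E.HasGoodReductionAtPrime p ∧
      ¬ (p : ℤ) ∣ Curve389a1.E.frobeniusTrace p ∧ (∀ n : ℕ, Curve389a1.E.HasSurjectiveModNGaloisRep (p ^ n : ℕ)) ∧
      (∀ v : HeightOneSpectrum (𝓞 ℚ), Curve389a1.E.HasMultiplicativeReductionAt v →
        ¬ p ∣ Curve389a1.E.ordMinimalDiscriminant v) ∧
      ∃ (K : Type) (_ : Field K) (_ : NumberField K), IsImaginaryQuadratic K ∧
        NumberField.discr K ≠ -3 ∧ NumberField.discr K ≠ -4 ∧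
        ∃ (_ : NeZero (Curve389a1.E.conductorNorm ℤ)), SatisfiesHeegnerHypothesis (Curve389a1.E.conductorNorm ℤ) K ∧
        ∃ (Dt : ModularParametrizationData Curve389a1.E (Curve389a1.E.conductorNorm ℤ)) (β : ℤ) (ι : K →+* ℂ) (n₁ : ℕ)
          (d : KolyvaginHeegnerData Dt β ι n₁), Squarefree n₁ ∧
          (∀ q ∈ n₁.primeFactors, Zhang2014.IsKolyvaginPrime (Curve389a1.E.conductorNorm ℤ) Curve389a1.E K p q) ∧
          d.kolyvaginClass hp.out 1 ≠ 0 ∧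
          (n₁.primeFactors.card + 1 ≤ Curve389a1.E.mordellWeilRank ∨
            (n₁.primeFactors.card ≤ Curve389a1.E.mordellWeilRank ∧
              n₁.primeFactors.card + 1 ≤ (Curve389a1.E.quadraticTwist (NumberField.discr K : ℚ)).mordellWeilRank)) := by
  haveI := curve389a1_isGloballyMinimal
  haveI iT := minTwist7_isElliptic
  haveI := minTwist7_isGloballyMinimal
  set T := (⟨0, -1, 1, -114, -302⟩ : WeierstrassCurve ℤ).map (Int.castRingHom ℚ) with hT
  -- `ρ̄_{T,p}` onto, from `ρ̄_{E,p}` onto (generic twist transport)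
  have hsurE : Curve389a1.E.HasSurjectiveModNGaloisRep p := by simpa only [pow_one] using htower 1
  have hTsur : T.HasSurjectiveModNGaloisRep p :=
    hasSurjectiveModNGaloisRep_of_smul_eq_quadraticTwist Curve389a1.E T (by norm_num : (-7 : ℚ) ≠ 0)
      minTwist7_smul_eq p hsurE
  -- `#Sel_p(T) ≤ p²` from the BSD quotient with tolerance `1`
  have hSelT : Nat.card (T.selmerGroup p) ≤ p ^ (1 + 1) :=
    natCard_selmerGroup_le_pow_succ_of_rankOne_bsdQuotient_bcs hBCS hGZK T p h5 minTwist7_not_hasCM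
      (minTwist7_hasGoodReductionAtPrime_of p hp7 hgood) hTord hTsur (minTwist7_kodairaNeron_of_five_le p h5) hr 1 hval
  have hSel : Nat.card ((Curve389a1.E.quadraticTwist (NumberField.discr K : ℚ)).selmerGroup p) ≤ p ^ 2 := by
    have hcast : (NumberField.discr K : ℚ) = (-7 : ℚ) := by rw [hD]; norm_num
    rw [hcast, ← natCard_selmerGroup_eq_of_variableChange (p : ℤ) minTwist7_smul_eq]
    exact hSelT
  exact cruxBody_of_twistSelmer_at hSW h84 p h5 hp1000 hp7 hgood hord htower K hK hD hSel

/-- **Ordinarity of the twist from ordinarity of the curve**: for a prime `p ∉ {2, 7}` of good reduction for `E = 389a1`, `p ∤ a_p(T₀)` iff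
`p ∤ a_p(E)` — by the tree's PROVED twisting formula `a_p(T₀) = (−7/p)·a_p(E)` (`frobeniusTrace_quadraticTwist_holds`, Knapp Prop. 12.10),
the Legendre symbol being `±1`. [cite: Knapp1993, Prop. 12.10 (PDF pp. 302–303)] [cite: SilvermanAEC2009, X.2 Prop. 2.4] -/
theorem minTwist7_not_dvd_frobeniusTrace_of (p : ℕ) [hp : Fact p.Prime] (hp2 : p ≠ 2) (hp7 : p ≠ 7)
    (hgood : haveI := curve389a1_isGloballyMinimal; Curve389a1.E.HasGoodReductionAtPrime p)
    (hord : haveI := curve389a1_isGloballyMinimal; ¬ (p : ℤ) ∣ Curve389a1.E.frobeniusTrace p) :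
    haveI := minTwist7_isGloballyMinimal;
    ¬ (p : ℤ) ∣ ((⟨0, -1, 1, -114, -302⟩ : WeierstrassCurve ℤ).map (Int.castRingHom ℚ)).frobeniusTrace p := by
  haveI := curve389a1_isGloballyMinimal
  haveI := minTwist7_isElliptic
  haveI := minTwist7_isGloballyMinimal
  have hpP : p.Prime := hp.out
  have hpd : ¬ ((p : ℤ) ∣ 2 * (-7 : ℤ)) := by
    intro h
    rcases (Nat.prime_iff_prime_int.mp hpP).dvd_or_dvd h with h2 | h7
    · exact hp2 ((Nat.prime_dvd_prime_iff_eq hpP Nat.prime_two).mp (by exact_mod_cast h2))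
    · have h7' : (p : ℤ) ∣ 7 := (dvd_neg.mp h7)
      exact hp7 ((Nat.prime_dvd_prime_iff_eq hpP (by norm_num)).mp (by exact_mod_cast h7'))
  have hΔ : ¬ (p : ℤ) ∣ Curve389a1.E.minimalDiscriminantInt :=
    Curve389a1.E.not_dvd_minimalDiscriminantInt_of_hasGoodReductionAtPrime p hgood
  have htw := frobeniusTrace_quadraticTwist_holds Curve389a1.E
    ((⟨0, -1, 1, -114, -302⟩ : WeierstrassCurve ℤ).map (Int.castRingHom ℚ)) (-7)
    (by rw [← Int.squarefree_natAbs]; exact (Nat.prime_iff.mp (by norm_num : Nat.Prime 7)).squarefree)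
    ⟨_, by exact_mod_cast minTwist7_smul_eq⟩ p hpd hΔ
  rw [htw]
  intro hdvd
  have h7p : ((-7 : ℤ) : ZMod p) ≠ 0 := by
    intro h0
    have : (p : ℤ) ∣ -7 := (ZMod.intCast_zmod_eq_zero_iff_dvd _ p).mp h0
    exact hp7 ((Nat.prime_dvd_prime_iff_eq hpP (by norm_num)).mp (by exact_mod_cast (dvd_neg.mp this)))
  rcases legendreSym.eq_one_or_neg_one p h7p with h1 | h1 <;> rw [h1] at hdvd
  · exact hord (by simpa using hdvd)
  · exact hord (by simpa using hdvd)

/-- **THE CRUX AT `389a1` FROM ONE BSD-QUOTIENT VALUATION AT ANY ADMISSIBLE PRIME — fully `E`-sided hypotheses.** As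
`cruxBody_of_twistBSDQuotient_at`, with the twist's ordinarity at `p` DERIVED from `E`'s (`minTwist7_not_dvd_frobeniusTrace_of`): for every
`5 ≤ p < 1000`, `p ≠ 7`, with `389a1` good ordinary at `p` and `ρ_{E,p^n}` onto, ONE `K` with `d_K = −7`, and the two analytic hypotheses on
`T₀ = [0,−1,1,−114,−302]` — `ord_{s=1} L(T₀,s) = 1`, `ord_p(L'(T₀,1)/(Ω·Reg)) ≤ 1` — the clause of `KolyvaginDepthSupplyKN` holds at `389a1`
VERBATIM. Every `T`-side arithmetic condition (surjectivity, good ordinary reduction, Kodaira–Néron, non-CM, minimality) is now a theorem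
uniform in `p`. CONDITIONAL on SW Thm. 1.1, W. Zhang L8.4 (1) / 9.1, BCS 2025 Cor. 1.3.1, GZK by name; per curve; BSD is not proved by it.
[cite: BurungaleCastellaSkinner2025, Cor. 1.3.1 (p. 4)] [cite: Darmon2004, Thm. 3.22] [cite: SteinWuthrich2013, Thm. 1.1 (p. 1758)]
[cite: WZhang2014, Lemma 8.4 (1) (p. 236), Thm. 9.1 (p. 240)] [cite: Knapp1993, Prop. 12.10] -/
theorem cruxBody_of_twistBSDQuotient_at'
    (hSW : SteinWuthrich2013_sha_inf_torsionBy_eq_bot_of_two_le_rank)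
    (h84 : Literature.NumberTheory.EllipticCurves.WZhang2014_lemma84_exists_minimal_kolyvaginClass_one_selmerCard)
    (hBCS : BurungaleCastellaSkinner2025.cor131_padicValRat_bsd_rank_le_one)
    (hGZK : rank_eq_analyticRank_of_analyticRank_le_one)
    (p : ℕ) [hp : Fact p.Prime] (h5 : 5 ≤ p) (hp1000 : p < 1000) (hp7 : p ≠ 7)
    (hgood : haveI := curve389a1_isGloballyMinimal; Curve389a1.E.HasGoodReductionAtPrime p)
    (hord : haveI := curve389a1_isGloballyMinimal; ¬ (p : ℤ) ∣ Curve389a1.E.frobeniusTrace p)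
    (htower : ∀ n : ℕ, Curve389a1.E.HasSurjectiveModNGaloisRep (p ^ n : ℕ))
    (K : Type) [Field K] [NumberField K] (hK : IsImaginaryQuadratic K) (hD : NumberField.discr K = -7)
    (hr : haveI := minTwist7_isElliptic;
      ((⟨0, -1, 1, -114, -302⟩ : WeierstrassCurve ℤ).map (Int.castRingHom ℚ)).analyticRank = 1)
    (hval : haveI := minTwist7_isElliptic; haveI := minTwist7_isGloballyMinimal;
      ∀ q : ℚ, ((⟨0, -1, 1, -114, -302⟩ : WeierstrassCurve ℤ).map (Int.castRingHom ℚ)).leadingLCoeff /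
          (((((⟨0, -1, 1, -114, -302⟩ : WeierstrassCurve ℤ).map (Int.castRingHom ℚ)).realPeriodRat *
              ((⟨0, -1, 1, -114, -302⟩ : WeierstrassCurve ℤ).map (Int.castRingHom ℚ)).regulator : ℝ)) : ℂ) = (q : ℂ) →
        padicValRat p q ≤ 1) :
    haveI := curve389a1_isGloballyMinimal;
    ∃ (p : ℕ) (hp : Fact p.Prime), 5 ≤ p ∧ Curve389a1.E.HasGoodReductionAtPrime p ∧
      ¬ (p : ℤ) ∣ Curve389a1.E.frobeniusTrace p ∧ (∀ n : ℕ, Curve389a1.E.HasSurjectiveModNGaloisRep (p ^ n : ℕ)) ∧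
      (∀ v : HeightOneSpectrum (𝓞 ℚ), Curve389a1.E.HasMultiplicativeReductionAt v →
        ¬ p ∣ Curve389a1.E.ordMinimalDiscriminant v) ∧
      ∃ (K : Type) (_ : Field K) (_ : NumberField K), IsImaginaryQuadratic K ∧
        NumberField.discr K ≠ -3 ∧ NumberField.discr K ≠ -4 ∧
        ∃ (_ : NeZero (Curve389a1.E.conductorNorm ℤ)), SatisfiesHeegnerHypothesis (Curve389a1.E.conductorNorm ℤ) K ∧
        ∃ (Dt : ModularParametrizationData Curve389a1.E (Curve389a1.E.conductorNorm ℤ)) (β : ℤ) (ι : K →+* ℂ) (n₁ : ℕ)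
          (d : KolyvaginHeegnerData Dt β ι n₁), Squarefree n₁ ∧
          (∀ q ∈ n₁.primeFactors, Zhang2014.IsKolyvaginPrime (Curve389a1.E.conductorNorm ℤ) Curve389a1.E K p q) ∧
          d.kolyvaginClass hp.out 1 ≠ 0 ∧
          (n₁.primeFactors.card + 1 ≤ Curve389a1.E.mordellWeilRank ∨
            (n₁.primeFactors.card ≤ Curve389a1.E.mordellWeilRank ∧
              n₁.primeFactors.card + 1 ≤ (Curve389a1.E.quadraticTwist (NumberField.discr K : ℚ)).mordellWeilRank)) :=
  cruxBody_of_twistBSDQuotient_at hSW h84 hBCS hGZK p h5 hp1000 hp7 hgood hord htower K hK hD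
    (minTwist7_not_dvd_frobeniusTrace_of p (by omega) hp7 hgood hord) hr hval

/-- **THE EXACT `389a1` ROW, UNIFORM IN THE PRIME: at EVERY admissible `p`, «one Kolyvagin bit at `(389a1, p, ℚ(√−7))`» ⟺ «the BSD quotient
of ONE FIXED rank-one curve is a `p`-adic unit».** For every `5 ≤ p < 1000`, `p ≠ 7`, with `389a1` good ordinary at `p` and `ρ_{E,p^n}`
onto, every `K` with `d_K = −7`, GRANTED `ord_{s=1} L(T₀,s) = 1` for `T₀ = [0,−1,1,−114,−302]`: bit `↔ ∃ q ∈ ℚ, L'(T₀,1)/(Ω·Reg) = q ∧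
ord_p q = 0`. The number `L'(T₀,1)/(Ω_{T₀} Reg_{T₀})` does not depend on `p` (numerically `= c(T₀) = 1`, CERT-TABLE): so the row
PREDICTS the bit `= 1` at every admissible prime at once. From g17's uniform iff `exactRowZhang_neg7_twistSelmer_at`, transport along
`minTwist7_smul_eq`, and `natCard_selmerGroup_le_iff_bsdQuotient_unit_bcs` with all `T`-side conditions derived from `E`
(`hasSurjectiveModNGaloisRep_of_smul_eq_quadraticTwist`, `minTwist7_hasGoodReductionAtPrime_of`, `minTwist7_not_dvd_frobeniusTrace_of`,
`minTwist7_kodairaNeron_of_five_le`). CONDITIONAL on (γ), W. Zhang L8.4 (1) / 9.1, SW Thm. 1.1, BCS 2025 Cor. 1.3.1, GZK by name; per curve;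
BSD is not proved by it. [cite: BurungaleCastellaSkinner2025, Cor. 1.3.1 (p. 4)] [cite: Darmon2004, Thm. 3.22]
[cite: SteinWuthrich2013, Thm. 1.1 (p. 1758)] [cite: WZhang2014, Lemma 8.4 (1) (p. 236), Thm. 9.1 (p. 240)] [cite: GrossLMS1991, Prop. 3.7 (2)] -/
theorem exactRow_neg7_bsdQuotientUnit_at
    (hSW : SteinWuthrich2013_sha_inf_torsionBy_eq_bot_of_two_le_rank)
    (h372 : GrossLMS1991.prop37_2_frobeniusCongruence)
    (h84 : Literature.NumberTheory.EllipticCurves.WZhang2014_lemma84_exists_minimal_kolyvaginClass_one_selmerCard)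
    (hBCS : BurungaleCastellaSkinner2025.cor131_padicValRat_bsd_rank_le_one)
    (hGZK : rank_eq_analyticRank_of_analyticRank_le_one)
    (p : ℕ) [hp : Fact p.Prime] (h5 : 5 ≤ p) (hp1000 : p < 1000) (hp7 : p ≠ 7)
    (hgood : haveI := curve389a1_isGloballyMinimal; Curve389a1.E.HasGoodReductionAtPrime p)
    (hord : haveI := curve389a1_isGloballyMinimal; ¬ (p : ℤ) ∣ Curve389a1.E.frobeniusTrace p)
    (htower : ∀ n : ℕ, Curve389a1.E.HasSurjectiveModNGaloisRep (p ^ n : ℕ))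
    (K : Type) [Field K] [NumberField K] (hK : IsImaginaryQuadratic K) (hD : NumberField.discr K = -7)
    (hr : haveI := minTwist7_isElliptic;
      ((⟨0, -1, 1, -114, -302⟩ : WeierstrassCurve ℤ).map (Int.castRingHom ℚ)).analyticRank = 1) :
    haveI := curve389a1_isGloballyMinimal;
    haveI : NeZero (Curve389a1.E.conductorNorm ℤ) := neZero_conductorNorm_of_isElliptic _;
    (∃ (Dt : ModularParametrizationData (Curve389a1.E) ((Curve389a1.E).conductorNorm ℤ)) (β : ℤ)
      (ι : K →+* ℂ) (ℓ : ℕ) (d : KolyvaginHeegnerData Dt β ι ℓ),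
      ℓ.Prime ∧ Zhang2014.IsKolyvaginPrime ((Curve389a1.E).conductorNorm ℤ) (Curve389a1.E) K p ℓ ∧
        d.kolyvaginClass hp.out 1 ≠ 0) ↔
    (haveI := minTwist7_isElliptic; haveI := minTwist7_isGloballyMinimal;
      ∃ q : ℚ, ((⟨0, -1, 1, -114, -302⟩ : WeierstrassCurve ℤ).map (Int.castRingHom ℚ)).leadingLCoeff /
          (((((⟨0, -1, 1, -114, -302⟩ : WeierstrassCurve ℤ).map (Int.castRingHom ℚ)).realPeriodRat *
              ((⟨0, -1, 1, -114, -302⟩ : WeierstrassCurve ℤ).map (Int.castRingHom ℚ)).regulator : ℝ)) : ℂ) = (q : ℂ) ∧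
        padicValRat p q = 0) := by
  haveI := curve389a1_isGloballyMinimal
  haveI : NeZero (Curve389a1.E.conductorNorm ℤ) := neZero_conductorNorm_of_isElliptic _
  refine (exactRowZhang_neg7_twistSelmer_at hSW h372 h84 p h5 hp1000 hp7 hgood hord htower K hK hD).trans ?_
  have hcast : (NumberField.discr K : ℚ) = ((-7) : ℚ) := by rw [hD]; norm_num
  rw [hcast, ← natCard_selmerGroup_eq_of_variableChange (p : ℤ) minTwist7_smul_eq]
  haveI := minTwist7_isElliptic
  haveI := minTwist7_isGloballyMinimal
  have hsurE : Curve389a1.E.HasSurjectiveModNGaloisRep p := by simpa only [pow_one] using htower 1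
  exact natCard_selmerGroup_le_iff_bsdQuotient_unit_bcs hBCS hGZK _ p h5 minTwist7_not_hasCM
    (minTwist7_hasGoodReductionAtPrime_of p hp7 hgood) (minTwist7_not_dvd_frobeniusTrace_of p (by omega) hp7 hgood hord)
    (hasSurjectiveModNGaloisRep_of_smul_eq_quadraticTwist Curve389a1.E _ (by norm_num : (-7 : ℚ) ≠ 0) minTwist7_smul_eq p hsurE)
    (minTwist7_kodairaNeron_of_five_le p h5) hr

end C389a1

end Summit.BirchSwinnertonDyer.BirchSwinnertonDyer.Theorems.KolyvaginDepthDoor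

end
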